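import Summits.BirchSwinnertonDyer.BirchSwinnertonDyer.Theorems.KolyvaginDepthDoorMSymbolCert433a1Twist11
import Summits.BirchSwinnertonDyer.BirchSwinnertonDyer.Theorems.KolyvaginDepthDoorDepthTableKuriharaRow389a1CertifiedT
import Summits.BirchSwinnertonDyer.BirchSwinnertonDyer.Theorems.KolyvaginDepthDoorDepthTableKuriharaRow433a1CertifiedE
import Literature.NumberTheory.EllipticCurves.BurungaleSkinnerTianWan2024.CyclotomicPConverseOverQProofs
import HarnessLib

/-!
# Route `KolyvaginDepthDoor`, crux `KolyvaginDepthSupplyKN` (stmt-BirchSwinnertonDyer-22820) —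
# DEPTH TABLE v28: the NEW row `433a1` @ `(7, −11)` with BOTH Kurihara claims PROVED (no computational claim)

Helper file of the lead prover of line `levelone` (kdd-p1 g33; `--supports stmt-BirchSwinnertonDyer-22820
--as helper`); it closes nothing and BSD is NOT proved by it. Sibling of `…KuriharaRow709a1CertifiedT` / `…Row997b1CertifiedT` for
the prime-conductor curve `433a1` at its ODD Heegner field `ℚ(√−11)` (socket `…KuriharaSocket433a1Neg11`):
* §1 the Kurihara data of `T₀ = 433a1 ⊗ χ₋11` at `(7, 113)` (logarithm table mod `113` of `…MSymbolCert433a1`; the twisted minus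
  sums `sigmaT` of `…MSymbolCert433a1Twist11`; `kSumT ≢ 0 (mod 7)` by `decide`);
* §2 `exists_kuriharaNumber_ne_zero_T0`: for every parametrisation datum of `T₀` at level `52393` the Kurihara number at
  `(7, 113)` is non-zero — the line `[r]⁺_g ∈ C ℤ` through `1/2` (`exists_mul_eq_half`) and the integrality of
  `[2/113]⁺_g = ((-4)) C` (`T₀[7]` irreducible, transported from `433a1` through the twist) make `C` a `7`-adic unit;
* §3 `C433a1.kuriharaClaimT_7_113` — the twist-side claim (hypothesis `hδT` of `C433a1.cruxBody_of_kuriharaClaims_7_neg11`) VERBATIM,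
  from modularity by name; `C433a1.cruxBody_of_print_7_neg11` — the row with both claims discharged (`C433a1.kuriharaClaim_7_3277` is
  the kernel-certified E-side, v27), conditional on the four print facts only.

References: [Kim2022StructureSelmer] Thm. 1.11, §1.4.3; [MazurTateTeitelbaum1986Invent] §I.8; [CremonaAlgorithms1997] §2.8, Table 1 (433a1);
[WZhang2014] L8.4 (1), Thm. 9.1; [Mazur1978] Cor. 4.1.
-/

set_option linter.dupNamespace false

noncomputable section

open scoped MatrixGroups ModularForm Classical NumberField
open CongruenceSubgroup
open Literature.NumberTheory.EllipticCurves Literature.NumberTheory.EllipticCurves.ModularForms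
open Literature.NumberTheory.EllipticCurves.BurungaleSkinnerTianWan2024
  (hasIrreducibleModPGaloisRep_of_smul_eq_quadraticTwist)
open Summit.BirchSwinnertonDyer.BirchSwinnertonDyer.Rank2Observatory
open Summit.BirchSwinnertonDyer.BirchSwinnertonDyer.Theorems.KolyvaginDepthDoor.MSymbolCert.Cert389a1
  (exists_mul_eq_half kuriharaNumber_ne_zero_of_const)
open Summit.BirchSwinnertonDyer.BirchSwinnertonDyer.Theorems.KolyvaginDepthDoor (C433a1.minTwist11_isElliptic
  C433a1.minTwist11_isGloballyMinimal C433a1.minTwist11_intModel C433a1.minTwist11_smul_eq)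

namespace Summit.BirchSwinnertonDyer.BirchSwinnertonDyer.Theorems.KolyvaginDepthDoor.MSymbolCert.Cert433a1

/-! ## §1 The Kurihara data of `T₀` at `(7, 113)` -/

/-- The table family for `n = 113` (the logarithm table `tab113` of the E-side record file `…MSymbolCert433a1`). [folklore] -/
def Tw1243 (ℓ : ℕ) : List ℕ := if ℓ = 113 then tab113 else []

/-- Admissibility of the table family. [folklore] -/
theorem Tw1243_ok : ∀ ℓ, Tw1243 ℓ = [] ∨ (ℓ.Prime ∧ tabOK ℓ 7 (Tw1243 ℓ) = true) := by
  intro ℓ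
  by_cases h : ℓ = 113
  · right
    rw [h, Tw1243, if_pos rfl]
    exact ⟨by norm_num, tabOK_113⟩
  · left; simp [Tw1243, h]

/-- Surjectivity at the prime factors of `113`. [folklore] -/
theorem Tw1243_surj : ∀ ℓ ∈ (113 : ℕ).primeFactors, tabSurj ℓ 7 (Tw1243 ℓ) = true := by
  rw [show (113 : ℕ).primeFactors = {113} from Nat.Prime.primeFactors (by norm_num)]
  intro ℓ hℓ
  rw [Finset.mem_singleton] at hℓ
  rw [hℓ, Tw1243, if_pos rfl]
  exact tabSurj_113

/-- The unit witness `sigmaT 2 = (-4)` (`7 ∤ (-4)`; decide). [folklore] -/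
theorem sigmaT_witness : sigmaT 2 = (-4) := by
  decide +kernel

set_option maxHeartbeats 4000000 in
/-- **The twisted Kurihara sum is `≢ 0 (mod 7)`** (decide in 4 chunks: `≡ 1`). [cite: Kim2022StructureSelmer, §1.4.3] -/
theorem kSumT_ne_zero : kSum 7 113 sigmaT (113 : ℕ).primeFactors Tw1243 ≠ 0 := by
  rw [show (113 : ℕ).primeFactors = {113} from Nat.Prime.primeFactors (by norm_num), kSum, sum_range_eq_of_chunks4 _ 113 29 29 29 26 rfl ((6 : ℕ) : ZMod 7) ((6 : ℕ) : ZMod 7) ((5 : ℕ) : ZMod 7) ((5 : ℕ) : ZMod 7) ?h0 ?h1 ?h2 ?h3]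
  · decide
  · decide +kernel
  · decide +kernel
  · decide +kernel
  · decide +kernel

/-! ## §2 The Kurihara number of the newform of `T₀` -/

/-- **`δ̃_{113}(T₀) ≢ 0 (mod 7)` from modularity of `433a1` by name.** For every modular parametrisation datum
`D` of `T₀` at a level equal to `52393`: the table logarithm `ψ` is surjective and `kuriharaNumber D.f 7 113 ψ ≠ 0`.
[cite: Kim2022StructureSelmer, §1.4.3] [cite: MazurTateTeitelbaum1986Invent, §I.8] -/
theorem exists_kuriharaNumber_ne_zero_T0 (hnf : exists_isNewformOf) (N : ℕ) (hN : N = 52393) [NeZero N]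
    (D : haveI := C433a1.minTwist11_isElliptic; ModularParametrizationData T0 N) :
    ∃ ψ : (ℓ : ℕ) → (ZMod ℓ)ˣ →* Multiplicative (ZMod 7),
      (∀ ℓ ∈ (113 : ℕ).primeFactors, Function.Surjective (ψ ℓ)) ∧ kuriharaNumber D.f 7 113 ψ ≠ 0 := by
  subst hN
  haveI := C433a1.minTwist11_isElliptic
  haveI := C433a1.minTwist11_isGloballyMinimal
  haveI := isElliptic_c433a1
  haveI := isGloballyMinimal_c433a1
  haveI : Fact (Nat.Prime 7) := ⟨by norm_num⟩
  haveI : NeZero (113 : ℕ) := ⟨by norm_num⟩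
  have hg := D.isNewformOf
  obtain ⟨C, hCall, hCval⟩ := exists_const_T0 hnf D.f hg
  -- `|C|_p ≥ 1`: `C k = 1/2`
  obtain ⟨k, hk⟩ := exists_mul_eq_half D.f hg.1 hg.coeffField_eq_bot hCall
  -- `|C|_p ≤ 1`: integrality at `2/113`, `sigmaT 2 = (-4)`; `T₀[7]` irreducible, transported through the twist
  have hirrE : (((⟨1, 0, 0, 0, 1⟩ : WeierstrassCurve ℤ).map (Int.castRingHom ℚ))).HasIrreducibleModPGaloisRep 7 :=
    hasIrreducibleModPGaloisRep_of_hasSurjectiveModNGaloisRep _ 7 C433a1.hasSurjectiveModNGaloisRep_7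
  have hirr : T0.HasIrreducibleModPGaloisRep 7 :=
    hasIrreducibleModPGaloisRep_of_smul_eq_quadraticTwist (((⟨1, 0, 0, 0, 1⟩ : WeierstrassCurve ℤ).map (Int.castRingHom ℚ))) T0 7 (d := -11) (by norm_num)
      C433a1.minTwist11_smul_eq hirrE
  have hle : ‖((ratPlusSymbol D.f (((2 : ℕ) : ℚ) / 113) : ℚ) : ℚ_[7])‖ ≤ 1 := by
    refine IsNewformOf.norm_ratPlusSymbol_le_one hg (by norm_num) hirr ?_
    have hden : (((2 : ℕ) : ℚ) / 113).den = 113 := by norm_num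
    rw [hden]; norm_num
  rw [hCval 2 (by norm_num) (by norm_num), sigmaT_witness] at hle
  -- hence `|C|_p = 1`
  have h2 : ‖(2 : ℚ_[7])‖ = 1 := by
    have := (Padic.norm_natCast_eq_one_iff (p := 7) (n := 2)).mpr (by norm_num)
    simpa using this
  have hv : ‖((((-4) : ℤ) : ℚ) : ℚ_[7])‖ = 1 := by
    rw [Rat.cast_intCast]
    refine le_antisymm (Padic.norm_int_le_one _) (not_lt.mp fun hlt => ?_)
    exact absurd (Padic.norm_intCast_lt_one_iff.mp hlt) (by norm_num)
  have hle' : ‖(C : ℚ_[7])‖ ≤ 1 := by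
    have e : ((C * (((-4) : ℤ) : ℚ) : ℚ) : ℚ_[7]) = (C : ℚ_[7]) * ((((-4) : ℤ) : ℚ) : ℚ_[7]) := by push_cast; ring
    rw [e, norm_mul, hv, mul_one] at hle
    exact hle
  have hk1 : ‖((k : ℤ) : ℚ_[7])‖ ≤ 1 := Padic.norm_int_le_one k
  have hprod : ‖(C : ℚ_[7])‖ * ‖((k : ℤ) : ℚ_[7])‖ = 1 := by
    have e : ((C * k : ℚ) : ℚ_[7]) = (C : ℚ_[7]) * ((k : ℤ) : ℚ_[7]) := by push_cast; ring
    rw [← norm_mul, ← e, hk]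
    push_cast
    rw [norm_div, norm_one, h2]; norm_num
  have hCp : ‖(C : ℚ_[7])‖ = 1 := by
    apply le_antisymm hle'
    nlinarith [norm_nonneg (C : ℚ_[7]), norm_nonneg ((k : ℤ) : ℚ_[7])]
  -- so numerator and denominator of `C` are prime to `p`
  have hCq : (C : ℚ_[7]) = ((C.num : ℤ) : ℚ_[7]) / ((C.den : ℕ) : ℚ_[7]) := by
    rw [← Rat.cast_intCast, ← Rat.cast_natCast, ← Rat.cast_div, Rat.num_div_den]
  have hdpos : 0 < ‖((C.den : ℕ) : ℚ_[7])‖ := norm_pos_iff.mpr (by exact_mod_cast C.den_ne_zero)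
  have hCp' : ‖((C.num : ℤ) : ℚ_[7])‖ = ‖((C.den : ℕ) : ℚ_[7])‖ := by
    rw [hCq, norm_div, div_eq_one_iff_eq hdpos.ne'] at hCp
    exact hCp
  have hden : ¬ 7 ∣ C.den := fun h => by
    have hlt : ‖((C.den : ℕ) : ℚ_[7])‖ < 1 := Padic.norm_natCast_lt_one_iff.mpr h
    have hnumlt : ‖((C.num : ℤ) : ℚ_[7])‖ < 1 := by rw [hCp']; exact hlt
    have hpnum : (7 : ℤ) ∣ C.num := Padic.norm_intCast_lt_one_iff.mp hnumlt
    have hgp : (7 : ℕ) ∣ Nat.gcd C.num.natAbs C.den := Nat.dvd_gcd (Int.natAbs_dvd_natAbs.mpr hpnum) h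
    rw [C.reduced] at hgp
    omega
  have hnum : ¬ (7 : ℤ) ∣ C.num := fun h => by
    have hlt : ‖((C.num : ℤ) : ℚ_[7])‖ < 1 := Padic.norm_intCast_lt_one_iff.mpr h
    have hden1 : ‖((C.den : ℕ) : ℚ_[7])‖ = 1 :=
      Padic.norm_natCast_eq_one_iff.mpr ((Nat.Prime.coprime_iff_not_dvd (by norm_num)).mpr hden)
    rw [hden1] at hCp'
    linarith
  refine ⟨tabFamily 7 Tw1243 Tw1243_ok, fun ℓ hℓ =>
    surjective_tabFamily 7 Tw1243 Tw1243_ok (Nat.prime_of_mem_primeFactors hℓ) (Tw1243_surj ℓ hℓ), ?_⟩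
  exact kuriharaNumber_ne_zero_of_const D.f 7 113 (by norm_num) Tw1243 Tw1243_ok sigmaT C hnum hden
    (fun a ha hac => hCval a ha hac) kSumT_ne_zero

end Summit.BirchSwinnertonDyer.BirchSwinnertonDyer.Theorems.KolyvaginDepthDoor.MSymbolCert.Cert433a1

/-! ## §3 The row: both claims discharged -/

namespace Summit.BirchSwinnertonDyer.BirchSwinnertonDyer.Theorems.KolyvaginDepthDoor

open WeierstrassCurve NumberField IsDedekindDomain
open Summit.BirchSwinnertonDyer.BirchSwinnertonDyer.Theorems

namespace C433a1

/-- **THE TWIST-SIDE KURIHARA CLAIM OF ROW `433a1` @ `(7, −11)` FROM MODULARITY BY NAME** (the claim for `T₀` @ `(7, 113)`,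
the hypothesis `hδT` of `cruxBody_of_kuriharaClaims_7_neg11` VERBATIM), proved from `exists_isNewformOf`
(`MSymbolCert.Cert433a1.exists_kuriharaNumber_ne_zero_T0`, `N(T₀) = 52393`).
[cite: Kim2022StructureSelmer, §1.4.3] [cite: MazurTateTeitelbaum1986Invent, §I.8] -/
theorem kuriharaClaimT_7_113 (hnf : exists_isNewformOf) :
    haveI := minTwist11_isElliptic; haveI := minTwist11_isGloballyMinimal;
    haveI : NeZero ((((⟨1, 0, 1, -3, -1333⟩ : WeierstrassCurve ℤ).map (Int.castRingHom ℚ))).conductorNorm ℤ) := neZero_conductorNorm_of_isElliptic _;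
    haveI := Fact.mk (by norm_num : Nat.Prime 7);
      ∀ (D : ModularParametrizationData (((⟨1, 0, 1, -3, -1333⟩ : WeierstrassCurve ℤ).map (Int.castRingHom ℚ))) ((((⟨1, 0, 1, -3, -1333⟩ : WeierstrassCurve ℤ).map (Int.castRingHom ℚ))).conductorNorm ℤ)),
        ¬ ((7 : ℕ) : ℤ) ∣ D.maninConstant →
        (∃ u : ℚ, ‖(u : ℚ_[7])‖ = 1 ∧
          (((⟨1, 0, 1, -3, -1333⟩ : WeierstrassCurve ℤ).map (Int.castRingHom ℚ))).realPeriodRat = u * plusPeriod D.f) →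
        ∃ ψ : (ℓ : ℕ) → (ZMod ℓ)ˣ →* Multiplicative (ZMod 7),
          (∀ ℓ ∈ (113 : ℕ).primeFactors, Function.Surjective (ψ ℓ)) ∧ kuriharaNumber D.f 7 113 ψ ≠ 0 := by
  intro D _ _
  haveI := minTwist11_isElliptic
  haveI : NeZero ((((⟨1, 0, 1, -3, -1333⟩ : WeierstrassCurve ℤ).map (Int.castRingHom ℚ))).conductorNorm ℤ) := neZero_conductorNorm_of_isElliptic _
  exact MSymbolCert.Cert433a1.exists_kuriharaNumber_ne_zero_T0 hnf _ MSymbolCert.Cert433a1.conductorNorm_T0 D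

/-- **DEPTH-TABLE ROW `433a1`, `(p, d_K) = (7, −11)`, v28 — NO COMPUTATIONAL CLAIM LEFT.** For every imaginary quadratic `K` with
`d_K = −11`: granted Kim's Thm. 1.11 (`hKim`), modularity (`hnf`), Mazur's Cor. 4.1 (`hMaz`) and W. Zhang's L8.4 (1)/9.1 (`h84`) BY NAME,
the clause of the crux `KolyvaginDepthSupplyKN` holds at `W = 433a1` VERBATIM — the socket `cruxBody_of_kuriharaClaims_7_neg11` with
BOTH Kurihara claims PROVED (`kuriharaClaim_7_3277`: kernel-certified plus M-symbol of `433a1`, v27; `kuriharaClaimT_7_113`: certified minus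
M-symbol and the twist formula, from `hnf`). CONDITIONAL on the four named print facts ONLY; per curve; nothing class-wide; BSD is not proved by it.
[cite: Kim2022StructureSelmer, Thm. 1.11 (PDF p. 8)] [cite: WZhang2014, Lemma 8.4 (1) (p. 236), Thm. 9.1 (p. 240)] [cite: Mazur1978, Cor. 4.1]
[cite: CremonaAlgorithms1997, Table 1 (433a1)] -/
theorem cruxBody_of_print_7_neg11
    (hKim : Kim2022_card_selmerGroup_le_pow_of_kuriharaNumber_ne_zero)
    (hnf : exists_isNewformOf) (hMaz : mazur_not_dvd_maninConstant_of_odd)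
    (h84 : Literature.NumberTheory.EllipticCurves.WZhang2014_lemma84_exists_minimal_kolyvaginClass_one_selmerCard)
    (K : Type) [Field K] [NumberField K] (hK : IsImaginaryQuadratic K) (hD : NumberField.discr K = -11) :
    haveI := isElliptic_c433a1; haveI := isGloballyMinimal_c433a1;
    ∃ (p : ℕ) (hp : Fact p.Prime), 5 ≤ p ∧ (((⟨1, 0, 0, 0, 1⟩ : WeierstrassCurve ℤ).map (Int.castRingHom ℚ))).HasGoodReductionAtPrime p ∧
      ¬ (p : ℤ) ∣ (((⟨1, 0, 0, 0, 1⟩ : WeierstrassCurve ℤ).map (Int.castRingHom ℚ))).frobeniusTrace p ∧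
      (∀ n : ℕ, (((⟨1, 0, 0, 0, 1⟩ : WeierstrassCurve ℤ).map (Int.castRingHom ℚ))).HasSurjectiveModNGaloisRep (p ^ n : ℕ)) ∧
      (∀ v : HeightOneSpectrum (𝓞 ℚ), (((⟨1, 0, 0, 0, 1⟩ : WeierstrassCurve ℤ).map (Int.castRingHom ℚ))).HasMultiplicativeReductionAt v →
        ¬ p ∣ (((⟨1, 0, 0, 0, 1⟩ : WeierstrassCurve ℤ).map (Int.castRingHom ℚ))).ordMinimalDiscriminant v) ∧
      ∃ (K : Type) (_ : Field K) (_ : NumberField K), IsImaginaryQuadratic K ∧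
        NumberField.discr K ≠ -3 ∧ NumberField.discr K ≠ -4 ∧
        ∃ (_ : NeZero ((((⟨1, 0, 0, 0, 1⟩ : WeierstrassCurve ℤ).map (Int.castRingHom ℚ))).conductorNorm ℤ)),
          SatisfiesHeegnerHypothesis ((((⟨1, 0, 0, 0, 1⟩ : WeierstrassCurve ℤ).map (Int.castRingHom ℚ))).conductorNorm ℤ) K ∧
        ∃ (Dt : ModularParametrizationData (((⟨1, 0, 0, 0, 1⟩ : WeierstrassCurve ℤ).map (Int.castRingHom ℚ))) ((((⟨1, 0, 0, 0, 1⟩ : WeierstrassCurve ℤ).map (Int.castRingHom ℚ))).conductorNorm ℤ))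
          (β : ℤ) (ι : K →+* ℂ) (n₁ : ℕ) (d : KolyvaginHeegnerData Dt β ι n₁), Squarefree n₁ ∧
          (∀ q ∈ n₁.primeFactors, Zhang2014.IsKolyvaginPrime ((((⟨1, 0, 0, 0, 1⟩ : WeierstrassCurve ℤ).map (Int.castRingHom ℚ))).conductorNorm ℤ)
            (((⟨1, 0, 0, 0, 1⟩ : WeierstrassCurve ℤ).map (Int.castRingHom ℚ))) K p q) ∧
          d.kolyvaginClass hp.out 1 ≠ 0 ∧
          (n₁.primeFactors.card + 1 ≤ (((⟨1, 0, 0, 0, 1⟩ : WeierstrassCurve ℤ).map (Int.castRingHom ℚ))).mordellWeilRank ∨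
            (n₁.primeFactors.card ≤ (((⟨1, 0, 0, 0, 1⟩ : WeierstrassCurve ℤ).map (Int.castRingHom ℚ))).mordellWeilRank ∧
              n₁.primeFactors.card + 1 ≤ ((((⟨1, 0, 0, 0, 1⟩ : WeierstrassCurve ℤ).map (Int.castRingHom ℚ))).quadraticTwist
                (NumberField.discr K : ℚ)).mordellWeilRank)) :=
  cruxBody_of_kuriharaClaims_7_neg11 hKim hnf hMaz h84 K hK hD kuriharaClaim_7_3277 (kuriharaClaimT_7_113 hnf)

end C433a1

end Summit.BirchSwinnertonDyer.BirchSwinnertonDyer.Theorems.KolyvaginDepthDoor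

end
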